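import Mathlib.LinearAlgebra.Matrix.Adjugate
import Mathlib.Data.Fintype.Perm
import Literature.NumberTheory.Transcendental.ChudnovskyHeights
import Literature.NumberTheory.Transcendental.GelfondCriterionProofs
import HarnessLib

/-!
# Chudnovsky's theorem on periods — bounds for the representing matrices and their determinants

Topic `Literature/NumberTheory/Transcendental` (trunk T-TRANSCEND). Node [BND] of the proof of
`Literature.NumberTheory.Transcendental.Chudnovsky1984_thm_7_3_1` (Chudnovsky 1984, Ch. 7, Theorem 3.1), companion of
`ChudnovskyHeights.lean`.

Chudnovsky 1984, Ch. 7, §2, pp. 306–307: the number `ξ = F^{(k₁)}(z₀) ≠ 0` is of the form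
`R(ω/π, η/ω)` with `R ∈ ℤ[x, y]` of type `O(L log L)`, and one takes "the norm of this number"
to get `P_N ∈ ℤ[x]` with `t(P_N) = O(L log L)` and `log |P_N(θ)| ≤ -c L³ log L`. In the matrix
form of `ChudnovskyHeights.lean` the norm is `det (homEval N b n P)`; this file supplies the
bookkeeping: degrees and `ℓ¹`-norms of the entries of `homEval N b n P` and of its determinant,
the size of the entries at `θ`, and the **cofactor bound** `|det M| ≤ |y| · d (1 + dR)^d` for a
matrix `M ∈ M_d(ℂ)` with entries `≤ R` having a row eigenvector with eigenvalue `y` (Cramer's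
rule: `det M · v = y · v · adj M`).

## Contents (no definitions)

* `seminorm_mul_entry_le`, `seminorm_pow_entry_le`, `seminorm_monoEval_entry_le`,
  `seminorm_homEval_entry_le` — entry bounds for a ring seminorm.
* `natDegree_mul_entry_le`, …, `natDegree_homEval_entry_le` — degree bounds over `ℤ[T]`.
* `natDegree_det_le_of_entry`, `zl1_det_le_of_entry` — the determinant over `ℤ[T]`.
* `norm_det_le_of_vecMul` — the cofactor bound over `ℂ`.
-/

noncomputable section

open scoped Polynomial
open Matrix Finset MvPolynomial

namespace Literature.NumberTheory.Transcendental.Chudnovsky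

/-! ### Entry bounds for a ring seminorm -/

section Seminorm

variable {R : Type*} [CommRing R] (ν : RingSeminorm R) {d : ℕ}

/-- `ν` of a finite sum is at most the sum of the `ν`'s. [folklore] -/
lemma seminorm_sum_le {ι : Type*} (s : Finset ι) (g : ι → R) :
    ν (∑ i ∈ s, g i) ≤ ∑ i ∈ s, ν (g i) :=
  Finset.le_sum_of_subadditive ν (map_zero ν).le (map_add_le_add ν) s g

/-- `ν` of a finite product is at most the product of the `ν`'s (`ν 1 ≤ 1`). [folklore] -/
lemma seminorm_prod_le (h1 : ν 1 ≤ 1) {ι : Type*} (s : Finset ι) (g : ι → R) :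
    ν (∏ i ∈ s, g i) ≤ ∏ i ∈ s, ν (g i) := by
  classical
  induction s using Finset.induction_on with
  | empty => simpa using h1
  | insert a s ha ih =>
    rw [Finset.prod_insert ha, Finset.prod_insert ha]
    exact (map_mul_le_mul ν _ _).trans (mul_le_mul_of_nonneg_left ih (apply_nonneg _ _))

/-- Entries of a product: `ν ((AB)_{ij}) ≤ d · a · b`. [folklore] -/
lemma seminorm_mul_entry_le {A B : Matrix (Fin d) (Fin d) R} {a b : ℝ} (ha0 : 0 ≤ a)
    (ha : ∀ i j, ν (A i j) ≤ a) (hb : ∀ i j, ν (B i j) ≤ b) (i j : Fin d) :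
    ν ((A * B) i j) ≤ d * (a * b) := by
  rw [Matrix.mul_apply]
  refine (seminorm_sum_le ν _ _).trans ?_
  calc ∑ k, ν (A i k * B k j) ≤ ∑ _k : Fin d, a * b :=
        Finset.sum_le_sum fun k _ => (map_mul_le_mul ν _ _).trans
          (mul_le_mul (ha i k) (hb k j) (apply_nonneg _ _) ha0)
    _ = d * (a * b) := by simp

/-- Entries of a power: `ν ((A^k)_{ij}) ≤ (d a)^k` (`a ≥ 1`, `ν 1 ≤ 1`). [folklore] -/
lemma seminorm_pow_entry_le (h1 : ν 1 ≤ 1) {A : Matrix (Fin d) (Fin d) R} {a : ℝ} (ha1 : 1 ≤ a)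
    (ha : ∀ i j, ν (A i j) ≤ a) (k : ℕ) (i j : Fin d) : ν ((A ^ k) i j) ≤ (d * a) ^ k := by
  induction k generalizing i j with
  | zero =>
    rw [pow_zero, pow_zero, Matrix.one_apply]
    split_ifs
    · exact h1
    · rw [map_zero]; exact zero_le_one
  | succ k ih =>
    rw [pow_succ]
    have hd : (1 : ℝ) ≤ d := by
      have : 0 < d := Fin.pos i
      exact_mod_cast this
    refine (seminorm_mul_entry_le ν (by positivity) ih ha i j).trans (le_of_eq ?_)
    ring

/-- Entries of an ordered monomial: `ν ((N^α)_{ij}) ≤ d³ (d H)^{|α|}` (`H ≥ 1`, `ν 1 ≤ 1`).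
[folklore] -/
lemma seminorm_monoEval_entry_le (h1 : ν 1 ≤ 1) {N : Fin 4 → Matrix (Fin d) (Fin d) R} {H : ℝ}
    (hH : 1 ≤ H) (hN : ∀ l i j, ν (N l i j) ≤ H) (α : Fin 4 →₀ ℕ) (i j : Fin d) :
    ν (monoEval N α i j) ≤ (d : ℝ) ^ 3 * (d * H) ^ α.degree := by
  have hd : (1 : ℝ) ≤ d := by
    have : 0 < d := Fin.pos i
    exact_mod_cast this
  have hdH : 1 ≤ (d : ℝ) * H := by nlinarith
  have hp := fun l => seminorm_pow_entry_le ν h1 hH (hN l) (α l)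
  unfold monoEval
  have h01 := seminorm_mul_entry_le ν (by positivity) (hp 0) (hp 1)
  have h012 := seminorm_mul_entry_le ν (by positivity) h01 (hp 2)
  have h0123 := seminorm_mul_entry_le ν (by positivity) h012 (hp 3)
  refine (h0123 i j).trans (le_of_eq ?_)
  rw [Finsupp.degree_eq_sum, Fin.sum_univ_four]
  ring

/-- **Entries of `homEval`**: if `ν b ≤ H`, `ν (N_l)_{ij} ≤ H` (`H ≥ 1`) and all monomials of
`P` have degree `≤ n`, then `ν ((homEval N b n P)_{ij}) ≤ wnorm ν P · d³ (dH)^n`. [folklore] -/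
theorem seminorm_homEval_entry_le (h1 : ν 1 ≤ 1) {N : Fin 4 → Matrix (Fin d) (Fin d) R} {b : R}
    {H : ℝ} (hH : 1 ≤ H) (hN : ∀ l i j, ν (N l i j) ≤ H) (hb : ν b ≤ H) {n : ℕ}
    {P : MvPolynomial (Fin 4) R} (hP : ∀ α ∈ P.support, α.degree ≤ n) (i j : Fin d) :
    ν (homEval N b n P i j) ≤ wnorm ν P * ((d : ℝ) ^ 3 * (d * H) ^ n) := by
  have hd : (1 : ℝ) ≤ d := by
    have : 0 < d := Fin.pos i
    exact_mod_cast this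
  unfold homEval
  rw [Matrix.sum_apply]
  refine (seminorm_sum_le ν _ _).trans ?_
  unfold wnorm
  rw [Finset.sum_mul]
  refine Finset.sum_le_sum fun α hα => ?_
  rw [Matrix.smul_apply, smul_eq_mul]
  refine (map_mul_le_mul ν _ _).trans ?_
  refine (mul_le_mul (map_mul_le_mul ν _ _) (seminorm_monoEval_entry_le ν h1 hH hN α i j)
    (apply_nonneg _ _) (mul_nonneg (apply_nonneg _ _) (apply_nonneg _ _))).trans ?_
  have hbn : ν (b ^ (n - α.degree)) ≤ (d * H) ^ (n - α.degree) := by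
    refine (map_pow_le_pow' h1 b _).trans ?_
    exact pow_le_pow_left₀ (apply_nonneg _ _) (hb.trans (by nlinarith)) _
  have hαn := hP α hα
  calc ν (P.coeff α) * ν (b ^ (n - α.degree)) * ((d : ℝ) ^ 3 * (d * H) ^ α.degree)
      ≤ ν (P.coeff α) * (d * H) ^ (n - α.degree) * ((d : ℝ) ^ 3 * (d * H) ^ α.degree) := by
        gcongr
    _ = ν (P.coeff α) * ((d : ℝ) ^ 3 * (d * H) ^ n) := by
        rw [show (d * H : ℝ) ^ n = (d * H) ^ (n - α.degree) * (d * H) ^ α.degree by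
          rw [← pow_add, Nat.sub_add_cancel hαn]]
        ring

end Seminorm

/-! ### Degree bounds over `ℤ[T]` -/

section Degree

variable {d : ℕ}

/-- Entries of a product: degrees add. [folklore] -/
lemma natDegree_mul_entry_le {A B : Matrix (Fin d) (Fin d) ℤ[X]} {a b : ℕ}
    (ha : ∀ i j, (A i j).natDegree ≤ a) (hb : ∀ i j, (B i j).natDegree ≤ b) (i j : Fin d) :
    ((A * B) i j).natDegree ≤ a + b := by
  rw [Matrix.mul_apply]
  refine Polynomial.natDegree_sum_le_of_forall_le _ _ fun k _ => ?_
  exact Polynomial.natDegree_mul_le.trans (add_le_add (ha i k) (hb k j))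

/-- Entries of a power: `deg ((A^k)_{ij}) ≤ k a`. [folklore] -/
lemma natDegree_pow_entry_le {A : Matrix (Fin d) (Fin d) ℤ[X]} {a : ℕ}
    (ha : ∀ i j, (A i j).natDegree ≤ a) (k : ℕ) (i j : Fin d) :
    ((A ^ k) i j).natDegree ≤ k * a := by
  induction k generalizing i j with
  | zero =>
    rw [pow_zero, Matrix.one_apply]
    split_ifs <;> simp
  | succ k ih =>
    rw [pow_succ]
    exact (natDegree_mul_entry_le ih ha i j).trans (by rw [Nat.succ_mul])

/-- Entries of an ordered monomial: `deg ≤ |α| δ₀`. [folklore] -/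
lemma natDegree_monoEval_entry_le {N : Fin 4 → Matrix (Fin d) (Fin d) ℤ[X]} {δ₀ : ℕ}
    (hN : ∀ l i j, (N l i j).natDegree ≤ δ₀) (α : Fin 4 →₀ ℕ) (i j : Fin d) :
    (monoEval N α i j).natDegree ≤ α.degree * δ₀ := by
  have hp := fun l => natDegree_pow_entry_le (hN l) (α l)
  unfold monoEval
  have h01 := natDegree_mul_entry_le (hp 0) (hp 1)
  have h012 := natDegree_mul_entry_le h01 (hp 2)
  have h0123 := natDegree_mul_entry_le h012 (hp 3)
  refine (h0123 i j).trans (le_of_eq ?_)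
  rw [Finsupp.degree_eq_sum, Fin.sum_univ_four]
  ring

/-- **Degrees of the entries of `homEval`**: `≤ δ_P + n δ₀` if the coefficients of `P` have degree
`≤ δ_P`, its monomials degree `≤ n`, and `b`, `N` have degree `≤ δ₀`. [folklore] -/
theorem natDegree_homEval_entry_le {N : Fin 4 → Matrix (Fin d) (Fin d) ℤ[X]} {b : ℤ[X]}
    {δ₀ δP n : ℕ} (hN : ∀ l i j, (N l i j).natDegree ≤ δ₀) (hb : b.natDegree ≤ δ₀)
    {P : MvPolynomial (Fin 4) ℤ[X]} (hP : ∀ α ∈ P.support, α.degree ≤ n)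
    (hPc : ∀ α, (P.coeff α).natDegree ≤ δP) (i j : Fin d) :
    (homEval N b n P i j).natDegree ≤ δP + n * δ₀ := by
  unfold homEval
  rw [Matrix.sum_apply]
  refine Polynomial.natDegree_sum_le_of_forall_le _ _ fun α hα => ?_
  rw [Matrix.smul_apply, smul_eq_mul]
  refine Polynomial.natDegree_mul_le.trans ?_
  have h1 : (P.coeff α * b ^ (n - α.degree)).natDegree ≤ δP + (n - α.degree) * δ₀ :=
    Polynomial.natDegree_mul_le.trans (add_le_add (hPc α)
      (Polynomial.natDegree_pow_le.trans (Nat.mul_le_mul_left _ hb)))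
  have h2 := natDegree_monoEval_entry_le hN α i j
  have h3 := hP α hα
  have : (n - α.degree) * δ₀ + α.degree * δ₀ = n * δ₀ := by
    rw [← Nat.add_mul, Nat.sub_add_cancel h3]
  omega

/-- **Degree of a determinant** over `ℤ[T]`: `deg det Y ≤ d · δ` if all entries have degree `≤ δ`.
[folklore] -/
theorem natDegree_det_le_of_entry {Y : Matrix (Fin d) (Fin d) ℤ[X]} {δ : ℕ}
    (hY : ∀ i j, (Y i j).natDegree ≤ δ) : Y.det.natDegree ≤ d * δ := by
  rw [Matrix.det_apply']
  refine Polynomial.natDegree_sum_le_of_forall_le _ _ fun σ _ => ?_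
  refine Polynomial.natDegree_mul_le.trans ?_
  have hsign : ((Equiv.Perm.sign σ : ℤ) : ℤ[X]).natDegree = 0 := Polynomial.natDegree_intCast _
  rw [hsign, zero_add]
  refine (Polynomial.natDegree_prod_le _ _).trans ?_
  calc ∑ i, (Y (σ i) i).natDegree ≤ ∑ _i : Fin d, δ := Finset.sum_le_sum fun i _ => hY _ _
    _ = d * δ := by simp

/-- **Height of a determinant** over `ℤ[T]`: `zl1 (det Y) ≤ (d H)^d` if all entries have
`zl1 ≤ H`. [folklore] -/
theorem zl1_det_le_of_entry {Y : Matrix (Fin d) (Fin d) ℤ[X]} {H : ℝ} (hH : 0 ≤ H)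
    (hY : ∀ i j, zl1 (Y i j) ≤ H) : zl1 Y.det ≤ ((d : ℝ) * H) ^ d := by
  rw [Matrix.det_apply']
  refine (seminorm_sum_le zl1 _ _).trans ?_
  have hterm : ∀ σ : Equiv.Perm (Fin d), zl1 (((Equiv.Perm.sign σ : ℤ) : ℤ[X]) * ∏ i, Y (σ i) i) ≤
      H ^ d := by
    intro σ
    refine (map_mul_le_mul zl1 _ _).trans ?_
    have hs : zl1 ((Equiv.Perm.sign σ : ℤ) : ℤ[X]) = 1 := by
      rcases Int.units_eq_one_or (Equiv.Perm.sign σ) with h | h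
      · rw [h, Units.val_one, Int.cast_one, zl1_one]
      · rw [h, Units.val_neg, Units.val_one, Int.cast_neg, Int.cast_one, map_neg_eq_map, zl1_one]
    rw [hs, one_mul]
    refine (seminorm_prod_le zl1 zl1_one.le _ _).trans ?_
    calc ∏ i, zl1 (Y (σ i) i) ≤ ∏ _i : Fin d, H :=
          Finset.prod_le_prod (fun i _ => apply_nonneg _ _) fun i _ => hY _ _
      _ = H ^ d := by simp
  calc ∑ σ : Equiv.Perm (Fin d), zl1 (((Equiv.Perm.sign σ : ℤ) : ℤ[X]) * ∏ i, Y (σ i) i)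
      ≤ ∑ _σ : Equiv.Perm (Fin d), H ^ d := Finset.sum_le_sum fun σ _ => hterm σ
    _ = (d.factorial : ℝ) * H ^ d := by
        rw [Finset.sum_const, Finset.card_univ, Fintype.card_perm, Fintype.card_fin, nsmul_eq_mul]
    _ ≤ (d : ℝ) ^ d * H ^ d := by
        gcongr
        exact_mod_cast Nat.factorial_le_pow d
    _ = ((d : ℝ) * H) ^ d := by rw [mul_pow]

end Degree

/-! ### The cofactor bound over `ℂ` -/

/-- **Cofactor bound.** If `v ≠ 0` is a row eigenvector of `M ∈ M_d(ℂ)` with eigenvalue `y`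
(`v M = y v`) and all `|M_{ij}| ≤ R`, then `|det M| ≤ |y| · d · (1 + d R)^d`: by Cramer's rule
`det M · v = v M adj(M) = y · v adj(M)`, and the entries of the adjugate are determinants with one
row replaced by a basis vector (`Matrix.norm_det_updateRow_single_le`). This is the "norm" step
of Gelfond's method (Chudnovsky 1984, Ch. 7, §2, p. 307: "if we denote by `P_N(π/ω)` the norm of
this number …"). [cite: Chudnovsky1984, Ch. 7 §2 p. 307] -/
theorem norm_det_le_of_vecMul {d : ℕ} (M : Matrix (Fin d) (Fin d) ℂ) {v : Fin d → ℂ}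
    (hv : v ≠ 0) {y : ℂ} (h : Matrix.vecMul v M = y • v) {R : ℝ}
    (hM : ∀ i j, ‖M i j‖ ≤ R) :
    ‖M.det‖ ≤ ‖y‖ * (d * (1 + d * R) ^ d) := by
  classical
  -- Cramer: `det M • v = y • (v ᵥ* adjugate M)`
  have hcr : M.det • v = y • Matrix.vecMul v M.adjugate := by
    have := congrArg (fun w => Matrix.vecMul w M.adjugate) h
    simp only [Matrix.vecMul_vecMul, Matrix.mul_adjugate, Matrix.smul_vecMul] at this
    rw [← this, Matrix.vecMul_smul, Matrix.vecMul_one]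
  -- an index where `|v|` is maximal
  have hd : 0 < d := by
    by_contra h0
    push Not at h0
    have : d = 0 := by omega
    subst this
    exact hv (funext fun i => Fin.elim0 i)
  haveI : Nonempty (Fin d) := ⟨⟨0, hd⟩⟩
  obtain ⟨i₀, -, hi₀⟩ := Finset.exists_max_image Finset.univ (fun i => ‖v i‖) Finset.univ_nonempty
  have hvi₀ : 0 < ‖v i₀‖ := by
    obtain ⟨i, hi⟩ := Function.ne_iff.mp hv
    exact (norm_pos_iff.mpr hi).trans_le (hi₀ i (Finset.mem_univ i))
  -- entries of the adjugate
  have hadj : ∀ i j, ‖M.adjugate i j‖ ≤ (1 + d * R) ^ d := by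
    intro i j
    rw [Matrix.adjugate_apply]
    refine (Matrix.norm_det_updateRow_single_le M j i (fun _ => d * R) fun j' => ?_).trans ?_
    · calc ∑ i', ‖M i' j'‖ ≤ ∑ _i' : Fin d, R := Finset.sum_le_sum fun i' _ => hM i' j'
        _ = d * R := by simp
    · simp
  -- compare the `i₀`-th coordinates
  have hcoord := congr_fun hcr i₀
  simp only [Pi.smul_apply, smul_eq_mul] at hcoord
  have hbound : ‖M.det‖ * ‖v i₀‖ ≤ ‖y‖ * (d * (1 + d * R) ^ d) * ‖v i₀‖ := by
    rw [← norm_mul, hcoord, norm_mul]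
    rw [mul_assoc]
    refine mul_le_mul_of_nonneg_left ?_ (norm_nonneg _)
    rw [Matrix.vecMul, dotProduct]
    calc ‖∑ i, v i * M.adjugate i i₀‖ ≤ ∑ i, ‖v i * M.adjugate i i₀‖ := norm_sum_le _ _
      _ ≤ ∑ _i : Fin d, ‖v i₀‖ * (1 + d * R) ^ d := by
          refine Finset.sum_le_sum fun i _ => ?_
          rw [norm_mul]
          exact mul_le_mul (hi₀ i (Finset.mem_univ i)) (hadj i i₀) (norm_nonneg _) (norm_nonneg _)
      _ = d * (1 + d * R) ^ d * ‖v i₀‖ := by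
          rw [Finset.sum_const, Finset.card_univ, Fintype.card_fin, nsmul_eq_mul]; ring
  exact le_of_mul_le_mul_right hbound hvi₀

end Literature.NumberTheory.Transcendental.Chudnovsky

end
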